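import Literature.NumberTheory.Rogawski1990.TransferFactsCartanKappa            -- ★ #72 ED. 5 + §2 (`finite_cartanIndex`, R7a, `cartanObsHasse`): the POINTED package
import Literature.NumberTheory.Rogawski1990.GlobalTransferWithCMCharIdentities    -- ★ P3b (J1) joint letter + ★ ED. 5 parametric `GlobalTransferWithStabilisationPackageAnd Q` + ★ `CMCharIdentityPackage`
import Literature.NumberTheory.Rogawski1990.FinExplicitTransferFactorConjRight    -- ★ N1f ⊕ N1f-l ⊕ N1f-r: `Δ‴ = finExplicitCollection …` UNCONDITIONAL
import Literature.NumberTheory.Rogawski1990.ArchCanonicalTransferFactor           -- ★ `archCanonicalDelta` ∕ `archCanonicalTransferFactor` = `Δ‴_∞`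
import Literature.NumberTheory.Automorphic.QuadraticHeckeCharacterCM              -- ★ `quadraticHeckeCharCM` = `ω_{L∕L⁺}` (the μ-guard)
import HarnessLib

/-!
# F0 ∕ P3a — `GlobalTransferWithStabilisationPackageAnd … Q` AT `Δ‴`, `Δ‴_∞` FROM THE STUB TEXTS (sorry-free compositions; the importable twin of the
# Lines workfile `Cruxes/H413/Lines/F0_P3a_GlobalTransferPackageAndPaydown.lean` (T6-L4) ED. 2, tree sha16 935b4dd9950d9002, §0 + §2)
# (cell `hodgecm-mathlib`, crux H413 = `stmt-HodgeConjecture-24833`; F0P3a-p01 (g9) for F0P3-plan (g7), WORD «B, STAGED» 2026-08-31T19:45:22Z)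

WHAT THIS FILE IS.  The `sorry`-FREE part of the registered pay-down line T6-L4, promoted VERBATIM to `Theorems/` (no `Cruxes/…/Lines/` import; the line's
import of the nested Lines module T6-L3 is dropped — nothing below reads it): §0 `stabilisationPackage_pointed` (lines :61–:135 of the Lines file: the per-class
stabilisation package of ★ `GlobalTransferWithStabilisationPackage` at a GIVEN collection from the κ-clause (4.3.3) there — PROVED, ★ R7a + ★ `cartanObsHasse`)
and §2 `globalTransferPackageAnd_of_stubs (hherm) (hJ) (hQ)` (lines :287–:423: the junction text (J‴) = T6-L3's pointed conclusion as the HYPOTHESIS `hJ`, the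
`Q`-rider as the frame hypothesis `hQ`, conclusion ★ `GlobalTransferWithStabilisationPackageAnd L H′ Δ‴_∞ νH νG Q` BY NAME), statements and proofs TOKEN FOR TOKEN;
only the namespace differs (`…Cruxes.H413.F0P3aGlobalTransferPackageAndOfStubs`).  `hJ` is discharged by the T6-L3 twin ★-to-be
`F0P3aGlobalTransferCartanKappaOfStubs.globalTransferCartanKappa_pointed_of_stubs` (letters N6, N7 as ITS hypotheses) in the assembly `Theorems/F0P3Rung0OfLetters.lean`.
NOT twinned: the sorried stubs (J‴) :166 and (Q-CM) :249, the `_holds` heads §3.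
HONEST LABEL: HC_CM is proved only modulo the printed citations until rung 0 closes; this file proves implications only and closes no stub; the Lines file stays the
line of record (drift rule F0P3-plan (g7) 19:45:22Z (2)).  Theorems only; no `def`, no instance, no notation; `--kind proof --supports stmt-HodgeConjecture-24833 --as helper`.

References: [Rogawski1990] §4.9 Prop. 4.9.1 p. 55, §4.3 (4.3.3) p. 44, §3.3 Prop. 3.3.1 p. 22, §5.4 (5.4.5) p. 73, §13.1 p. 199; [Kottwitz1986] §9;
[LanglandsShelstad1987] §6.4 Cor. 6.4.B.
-/

set_option autoImplicit false
set_option linter.dupNamespace false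

noncomputable section

open NumberField IsDedekindDomain MeasureTheory Measure
open Literature.NumberTheory.Rogawski1990 Literature.NumberTheory.Automorphic Literature.NumberTheory.GaloisRepresentations
open Literature.AlgebraicGeometry.ShimuraVarieties (unitaryGroup hermForm)
open scoped Matrix MatrixGroups Classical

namespace Summit.HodgeConjecture.HodgeConjecture.Cruxes.H413.F0P3aGlobalTransferPackageAndOfStubs

/-! ## §0 (PKG-pt) — PROVED: the per-class stabilisation package at a GIVEN collection from the κ-clause at that collection -/

section Pointed

variable (L : Type) [Field L] [NumberField L] [IsCMField L] (H' : Matrix (Fin 3) (Fin 3) L)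
  (Δinf : ↥(UnitaryGroup.arch (↥(maximalRealSubfield L)) L (IsCMField.complexConj L) 2
        (Matrix.of fun i j : Fin 2 => if i.val + j.val + 1 = 2 then (1 : L) else 0)) ×
      ↥(UnitaryGroup.arch (↥(maximalRealSubfield L)) L (IsCMField.complexConj L) 1
        (Matrix.of fun i j : Fin 1 => if i.val + j.val + 1 = 1 then (1 : L) else 0)) →
    ↥(UnitaryGroup.arch (↥(maximalRealSubfield L)) L (IsCMField.complexConj L) 3 H') → ℂ)
  (Δ : ∀ v : HeightOneSpectrum (𝓞 ↥(maximalRealSubfield L)), LocalTransferFactor L H' v)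

/-- **(PKG-pt) THE POINTED RUNG-0 SWAP**: for a hermitian `H′` and ANY global collection `(Δ_v)_v` with archimedean factor `Δ_∞`, the κ-CLAUSE of ★
`GlobalTransferWithCartanKappaFormula` at `(Δ, Δ_∞)` — the identity (4.3.3) `Δ_𝐀(γ_H, γ̄) Δ_∞ = (e 𝒪H)(cartanObs γ̄)` for Kottwitz's concrete obstruction and every
pinned dictionary `(s, e)` — implies the PER-CLASS STABILISATION PACKAGE of ★ ED. 4 `GlobalTransferWithStabilisationPackage` at the same `(Δ, Δ_∞)`: at a regular `γ₀` of
the anisotropic `U(H′)` take `A := A(γ₀)` (`cartanObsSubgroup (cartanIndexCM …)`, finite by ★ `finite_cartanIndex`), `𝓡 := ⊤`, `obs := cartanObs`, and `(s, e)` with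
clause (a) [Prop. 3.3.1] in character form from ★ R7a `MatchingAdeleG₂.exists_endoscopicKappaEquiv_of_obsHasse` fed with ★ R7 `cartanObsHasse`.  This is ★
`GlobalTransferWithCartanKappaFormula.stabilisationPackage'` with the `∃ (S_bad, Δ, mH, mG)` peeled off — the form the outer line needs to keep print's witness `Δ‴` in
hand. [cite: Rogawski1990, §3.3 Prop. 3.3.1 p. 22; §5.4 (5.4.5) p. 73; §4.3 (4.3.3) p. 44] [cite: Kottwitz1986, §9] [cite: LanglandsShelstad1987, §6.4 Cor. 6.4.B] -/
theorem stabilisationPackage_pointed (hherm : (H'.map (cmConjRingHom L))ᵀ = H')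
    (hκ :
          ((∀ x : Fin 3 → L, hermForm (cmConjRingHom L) H' x x = 0 → x = 0) →
            ∀ (hH : (H'.map (cmConjRingHom L))ᵀ = H') (hHd : IsUnit H'.det)
              (γ₀ : (UnitaryGroup.cmDatum L 3 H').Rational) (hreg : IsRegularElt (γ₀.val : GL (Fin 3) L))
              [Fintype (cartanIndexCM hH hHd hreg)]
              (s : {𝒪H : StableClassH (cmConjRingHom L) (Matrix.of fun i j : Fin 2 => if i.val + j.val + 1 = 2 then (1 : L) else 0)
                      (Matrix.of fun i j : Fin 1 => if i.val + j.val + 1 = 1 then (1 : L) else 0) //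
                    𝒪H.TransfersTo H' endoForm_antidiagOne (stableClassOf (cmConjRingHom L) H' γ₀)} → cartanIndexCM hH hHd hreg)
              (e : {𝒪H : StableClassH (cmConjRingHom L) (Matrix.of fun i j : Fin 2 => if i.val + j.val + 1 = 2 then (1 : L) else 0)
                      (Matrix.of fun i j : Fin 1 => if i.val + j.val + 1 = 1 then (1 : L) else 0) //
                    𝒪H.TransfersTo H' endoForm_antidiagOne (stableClassOf (cmConjRingHom L) H' γ₀)} ≃
                  {χ : (⊤ : Subgroup (AddChar ↥(cartanObsSubgroup (cartanIndexCM hH hHd hreg)) ℂ)) // χ ≠ 1}),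
              Function.Injective s →
              (∀ 𝔪 : cartanIndexCM hH hHd hreg, (∃ x, s x = 𝔪) ↔ Module.finrank L (↥(Algebra.adjoin L ({(((γ₀ : unitaryGroup (cmConjRingHom L) H').val : GL (Fin 3) L) : Matrix (Fin 3) (Fin 3) L)} :
                          Set (Matrix (Fin 3) (Fin 3) L))) ⧸ 𝔪.1.asIdeal) = 1) →
              (∀ x, (⟨(((γ₀ : unitaryGroup (cmConjRingHom L) H').val : GL (Fin 3) L) : Matrix (Fin 3) (Fin 3) L), Algebra.self_mem_adjoin_singleton L _⟩ :
                      ↥(Algebra.adjoin L ({(((γ₀ : unitaryGroup (cmConjRingHom L) H').val : GL (Fin 3) L) : Matrix (Fin 3) (Fin 3) L)} :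
                          Set (Matrix (Fin 3) (Fin 3) L)))) -
                  algebraMap L _ x.1.sndVal ∈ (s x).1.asIdeal) →
              (∀ x (ε : ↥(cartanObsSubgroup (cartanIndexCM hH hHd hreg))),
                  (((e x : (⊤ : Subgroup (AddChar ↥(cartanObsSubgroup (cartanIndexCM hH hHd hreg)) ℂ))) : AddChar ↥(cartanObsSubgroup (cartanIndexCM hH hHd hreg)) ℂ)) ε =
                    (-1 : ℂ) ^ ((ε : cartanIndexCM hH hHd hreg → ZMod 2) (s x)).val) →
              ∀ (γH : (UnitaryGroup.cmDatum L 2 (Matrix.of fun i j : Fin 2 => if i.val + j.val + 1 = 2 then (1 : L) else 0)).Rational ×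
                  (UnitaryGroup.cmDatum L 1 (Matrix.of fun i j : Fin 1 => if i.val + j.val + 1 = 1 then (1 : L) else 0)).Rational)
                (hγ : IsNormPair L H' γH γ₀),
                GlobalKappaFormula L H' Δ Δinf
                  (fun p : MatchingAdele L H' γH => MatchingAdeleG₂.cartanObs hH hHd hreg (MatchingAdele.toSelf hγ p))
                  (((e ⟨stableClassHOf (cmConjRingHom L) _ _ γH, hγ⟩).1 :
                      (⊤ : Subgroup (AddChar ↥(cartanObsSubgroup (cartanIndexCM hH hHd hreg)) ℂ))) : AddChar ↥(cartanObsSubgroup (cartanIndexCM hH hHd hreg)) ℂ))) :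
    ((∀ x : Fin 3 → L, hermForm (cmConjRingHom L) H' x x = 0 → x = 0) →
      ∀ γ₀ : (UnitaryGroup.cmDatum L 3 H').Rational, IsRegularElt (γ₀.val : GL (Fin 3) L) →
        ∃ (A : Type) (_ : AddCommGroup A) (𝓡 : Subgroup (AddChar A ℂ)) (_ : Fintype 𝓡) (obs : MatchingAdeleG₂ L H' H' γ₀ → A)
          (e : {𝒪H : StableClassH (cmConjRingHom L) (Matrix.of fun i j : Fin 2 => if i.val + j.val + 1 = 2 then (1 : L) else 0)
                  (Matrix.of fun i j : Fin 1 => if i.val + j.val + 1 = 1 then (1 : L) else 0) //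
                𝒪H.TransfersTo H' endoForm_antidiagOne (stableClassOf (cmConjRingHom L) H' γ₀)} ≃ {χ : 𝓡 // χ ≠ 1}),
          (∀ p : MatchingAdeleG₂ L H' H' γ₀, (∀ κ ∈ 𝓡, κ (obs p) = 1) ↔ ∃ γ, p.IsRationalOver γ) ∧
          ∀ (γH : (UnitaryGroup.cmDatum L 2 (Matrix.of fun i j : Fin 2 => if i.val + j.val + 1 = 2 then (1 : L) else 0)).Rational ×
              (UnitaryGroup.cmDatum L 1 (Matrix.of fun i j : Fin 1 => if i.val + j.val + 1 = 1 then (1 : L) else 0)).Rational)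
            (hγ : IsNormPair L H' γH γ₀),
            GlobalKappaFormula L H' Δ Δinf (fun p : MatchingAdele L H' γH => obs (MatchingAdele.toSelf hγ p))
              ((e ⟨stableClassHOf (cmConjRingHom L) _ _ γH, hγ⟩).1 : AddChar A ℂ)) := by
  intro hanis γ₀ hreg
  have hHd : IsUnit H'.det := isUnit_iff_ne_zero.mpr (Godement.det_ne_zero_of_anisotropic L H' hanis)
  haveI : Finite (cartanIndexCM hherm hHd hreg) :=
    finite_cartanIndex (cmConjRingHom L) (cmConjRingHom_algebraMap L) (IsCMField.complexConj_apply_apply L) hHd hherm hreg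
      (transpose_map_mul_mul_eq_of_rational γ₀)
  haveI : Fintype (cartanIndexCM hherm hHd hreg) := Fintype.ofFinite _
  haveI : Fintype (⊤ : Subgroup (AddChar ↥(cartanObsSubgroup (cartanIndexCM hherm hHd hreg)) ℂ)) := Fintype.ofFinite _
  obtain ⟨s, e, hs, hrange, hdict, hpin, hchar⟩ :=
    MatchingAdeleG₂.exists_endoscopicKappaEquiv_of_obsHasse hherm hHd hanis hreg (MatchingAdeleG₂.cartanObs hherm hHd hreg)
      (fun p => cartanObsHasse hherm hHd hreg p)
  exact ⟨_, inferInstance, ⊤, inferInstance, MatchingAdeleG₂.cartanObs hherm hHd hreg, e, hchar,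
    fun γH hγ => hκ hanis hherm hHd γ₀ hreg s e hs hrange hdict hpin γH hγ⟩

end Pointed

/-! ## §1 Frame of the line (= T6-L3's, VERBATIM) -/

variable (L : Type) [Field L] [NumberField L] [IsCMField L] (H' : Matrix (Fin 3) (Fin 3) L) (μ : HeckeCharacter L)
    [∀ v : HeightOneSpectrum (𝓞 ↥(maximalRealSubfield L)),
      MeasurableSpace ((UnitaryGroup.cmDatum L 2 (Matrix.of fun i j : Fin 2 => if i.val + j.val + 1 = 2 then (1 : L) else 0)).Local v ×
        (UnitaryGroup.cmDatum L 1 (Matrix.of fun i j : Fin 1 => if i.val + j.val + 1 = 1 then (1 : L) else 0)).Local v)]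
    [∀ v : HeightOneSpectrum (𝓞 ↥(maximalRealSubfield L)),
      BorelSpace ((UnitaryGroup.cmDatum L 2 (Matrix.of fun i j : Fin 2 => if i.val + j.val + 1 = 2 then (1 : L) else 0)).Local v ×
        (UnitaryGroup.cmDatum L 1 (Matrix.of fun i j : Fin 1 => if i.val + j.val + 1 = 1 then (1 : L) else 0)).Local v)]
    [∀ v : HeightOneSpectrum (𝓞 ↥(maximalRealSubfield L)), MeasurableSpace ((UnitaryGroup.cmDatum L 3 H').Local v)]
    [∀ v : HeightOneSpectrum (𝓞 ↥(maximalRealSubfield L)), BorelSpace ((UnitaryGroup.cmDatum L 3 H').Local v)]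
    (νH : ∀ v : HeightOneSpectrum (𝓞 ↥(maximalRealSubfield L)),
      Measure ((UnitaryGroup.cmDatum L 2 (Matrix.of fun i j : Fin 2 => if i.val + j.val + 1 = 2 then (1 : L) else 0)).Local v ×
        (UnitaryGroup.cmDatum L 1 (Matrix.of fun i j : Fin 1 => if i.val + j.val + 1 = 1 then (1 : L) else 0)).Local v))
    (νG : ∀ v : HeightOneSpectrum (𝓞 ↥(maximalRealSubfield L)), Measure ((UnitaryGroup.cmDatum L 3 H').Local v))
    [∀ v, (νH v).IsHaarMeasure] [∀ v, (νH v).IsMulRightInvariant] [∀ v, (νG v).IsHaarMeasure] [∀ v, (νG v).IsMulRightInvariant]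


/-! ## §2 The kernel-checked composition: (J‴) + (PKG-pt) + `hQ` ⟹ ★ `GlobalTransferWithStabilisationPackageAnd … Δ‴_∞ νH νG Q` BY NAME (no `sorry`) -/

section Composition

variable (Q : letI : ∀ (v : HeightOneSpectrum (𝓞 ↥(maximalRealSubfield L)))
          (a : ((UnitaryGroup.cmDatum L 2 (Matrix.of fun i j : Fin 2 => if i.val + j.val + 1 = 2 then (1 : L) else 0)).Local v ×
            (UnitaryGroup.cmDatum L 1 (Matrix.of fun i j : Fin 1 => if i.val + j.val + 1 = 1 then (1 : L) else 0)).Local v)),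
          MeasurableSpace (((UnitaryGroup.cmDatum L 2 (Matrix.of fun i j : Fin 2 => if i.val + j.val + 1 = 2 then (1 : L) else 0)).Local v ×
            (UnitaryGroup.cmDatum L 1 (Matrix.of fun i j : Fin 1 => if i.val + j.val + 1 = 1 then (1 : L) else 0)).Local v) ⧸
            Subgroup.centralizer ({a} : Set ((UnitaryGroup.cmDatum L 2 (Matrix.of fun i j : Fin 2 => if i.val + j.val + 1 = 2 then (1 : L) else 0)).Local v ×
            (UnitaryGroup.cmDatum L 1 (Matrix.of fun i j : Fin 1 => if i.val + j.val + 1 = 1 then (1 : L) else 0)).Local v))) :=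
        fun _ _ => borel _
      letI : ∀ (v : HeightOneSpectrum (𝓞 ↥(maximalRealSubfield L))) (γ : (UnitaryGroup.cmDatum L 3 H').Local v),
          MeasurableSpace ((UnitaryGroup.cmDatum L 3 H').Local v ⧸ Subgroup.centralizer ({γ} : Set ((UnitaryGroup.cmDatum L 3 H').Local v))) :=
        fun _ _ => borel _
      (∀ v : HeightOneSpectrum (𝓞 ↥(maximalRealSubfield L)), LocalTransferFactor L H' v) →
      (∀ v : HeightOneSpectrum (𝓞 ↥(maximalRealSubfield L)),
        OrbitalMeasureFamily ((UnitaryGroup.cmDatum L 2 (Matrix.of fun i j : Fin 2 => if i.val + j.val + 1 = 2 then (1 : L) else 0)).Local v ×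
          (UnitaryGroup.cmDatum L 1 (Matrix.of fun i j : Fin 1 => if i.val + j.val + 1 = 1 then (1 : L) else 0)).Local v)) →
      (∀ v : HeightOneSpectrum (𝓞 ↥(maximalRealSubfield L)), OrbitalMeasureFamily ((UnitaryGroup.cmDatum L 3 H').Local v)) → Prop)

/-- **`GlobalTransferWithStabilisationPackageAnd L H′ Δ‴_∞ νH νG Q` FROM THE STUB TEXTS** (composition; `sorry`-free): open the pointed data `(S_bad, mH, mG)` of (J‴);
the first three conjuncts are (J‴)'s verbatim at `Δ := Δ‴`; the per-class package is `stabilisationPackage_pointed` applied to (J‴)'s κ-clause; the rider `Q Δ‴ mH mG` is `hQ`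
at (J‴)'s canonical clauses. [cite: Rogawski1990, §4.9 Prop. 4.9.1 p. 55; §4.3 (4.3.3) p. 44; §3.3 Prop. 3.3.1 p. 22; §5.4 (5.4.5) p. 73; §13.1 p. 199] -/
theorem globalTransferPackageAnd_of_stubs (hherm : (H'.map (cmConjRingHom L))ᵀ = H')
    (hJ :
    (∀ v : HeightOneSpectrum (𝓞 ↥(maximalRealSubfield L)),
      νG v (UnitaryGroup.cmLocalIntegralLevel L 3 H' v : Set ((UnitaryGroup.cmDatum L 3 H').Local v)) = 1) →
    (∀ v : HeightOneSpectrum (𝓞 ↥(maximalRealSubfield L)),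
      νH v (((UnitaryGroup.cmLocalIntegralLevel L 2 (Matrix.of fun i j : Fin 2 => if i.val + j.val + 1 = 2 then (1 : L) else 0) v).prod
          (UnitaryGroup.cmLocalIntegralLevel L 1 (Matrix.of fun i j : Fin 1 => if i.val + j.val + 1 = 1 then (1 : L) else 0) v) :
            Subgroup ((UnitaryGroup.cmDatum L 2 (Matrix.of fun i j : Fin 2 => if i.val + j.val + 1 = 2 then (1 : L) else 0)).Local v ×
              (UnitaryGroup.cmDatum L 1 (Matrix.of fun i j : Fin 1 => if i.val + j.val + 1 = 1 then (1 : L) else 0)).Local v)) :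
          Set ((UnitaryGroup.cmDatum L 2 (Matrix.of fun i j : Fin 2 => if i.val + j.val + 1 = 2 then (1 : L) else 0)).Local v ×
            (UnitaryGroup.cmDatum L 1 (Matrix.of fun i j : Fin 1 => if i.val + j.val + 1 = 1 then (1 : L) else 0)).Local v)) = 1) →
    letI : ∀ (v : HeightOneSpectrum (𝓞 ↥(maximalRealSubfield L)))
        (a : ((UnitaryGroup.cmDatum L 2 (Matrix.of fun i j : Fin 2 => if i.val + j.val + 1 = 2 then (1 : L) else 0)).Local v ×
          (UnitaryGroup.cmDatum L 1 (Matrix.of fun i j : Fin 1 => if i.val + j.val + 1 = 1 then (1 : L) else 0)).Local v)),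
        MeasurableSpace (((UnitaryGroup.cmDatum L 2 (Matrix.of fun i j : Fin 2 => if i.val + j.val + 1 = 2 then (1 : L) else 0)).Local v ×
          (UnitaryGroup.cmDatum L 1 (Matrix.of fun i j : Fin 1 => if i.val + j.val + 1 = 1 then (1 : L) else 0)).Local v) ⧸
          Subgroup.centralizer ({a} : Set ((UnitaryGroup.cmDatum L 2 (Matrix.of fun i j : Fin 2 => if i.val + j.val + 1 = 2 then (1 : L) else 0)).Local v ×
          (UnitaryGroup.cmDatum L 1 (Matrix.of fun i j : Fin 1 => if i.val + j.val + 1 = 1 then (1 : L) else 0)).Local v))) :=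
      fun _ _ => borel _
    haveI : ∀ (v : HeightOneSpectrum (𝓞 ↥(maximalRealSubfield L)))
        (a : ((UnitaryGroup.cmDatum L 2 (Matrix.of fun i j : Fin 2 => if i.val + j.val + 1 = 2 then (1 : L) else 0)).Local v ×
          (UnitaryGroup.cmDatum L 1 (Matrix.of fun i j : Fin 1 => if i.val + j.val + 1 = 1 then (1 : L) else 0)).Local v)),
        BorelSpace (((UnitaryGroup.cmDatum L 2 (Matrix.of fun i j : Fin 2 => if i.val + j.val + 1 = 2 then (1 : L) else 0)).Local v ×
          (UnitaryGroup.cmDatum L 1 (Matrix.of fun i j : Fin 1 => if i.val + j.val + 1 = 1 then (1 : L) else 0)).Local v) ⧸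
          Subgroup.centralizer ({a} : Set ((UnitaryGroup.cmDatum L 2 (Matrix.of fun i j : Fin 2 => if i.val + j.val + 1 = 2 then (1 : L) else 0)).Local v ×
          (UnitaryGroup.cmDatum L 1 (Matrix.of fun i j : Fin 1 => if i.val + j.val + 1 = 1 then (1 : L) else 0)).Local v))) :=
      fun _ _ => ⟨rfl⟩
    letI : ∀ (v : HeightOneSpectrum (𝓞 ↥(maximalRealSubfield L))) (γ : (UnitaryGroup.cmDatum L 3 H').Local v),
        MeasurableSpace ((UnitaryGroup.cmDatum L 3 H').Local v ⧸ Subgroup.centralizer ({γ} : Set ((UnitaryGroup.cmDatum L 3 H').Local v))) :=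
      fun _ _ => borel _
    haveI : ∀ (v : HeightOneSpectrum (𝓞 ↥(maximalRealSubfield L))) (γ : (UnitaryGroup.cmDatum L 3 H').Local v),
        BorelSpace ((UnitaryGroup.cmDatum L 3 H').Local v ⧸ Subgroup.centralizer ({γ} : Set ((UnitaryGroup.cmDatum L 3 H').Local v))) :=
      fun _ _ => ⟨rfl⟩
    ∃ (Sbad : Finset (HeightOneSpectrum (𝓞 ↥(maximalRealSubfield L))))
      (mH : ∀ v : HeightOneSpectrum (𝓞 ↥(maximalRealSubfield L)), OrbitalMeasureFamily ((UnitaryGroup.cmDatum L 2 (Matrix.of fun i j : Fin 2 => if i.val + j.val + 1 = 2 then (1 : L) else 0)).Local v ×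
        (UnitaryGroup.cmDatum L 1 (Matrix.of fun i j : Fin 1 => if i.val + j.val + 1 = 1 then (1 : L) else 0)).Local v))
      (mG : ∀ v : HeightOneSpectrum (𝓞 ↥(maximalRealSubfield L)), OrbitalMeasureFamily ((UnitaryGroup.cmDatum L 3 H').Local v)),
      (∀ v, IsLocalTransferDatum L H' v ((finExplicitCollection L H' μ (finExplicitDelta_conj_left_all L H' μ) (finExplicitDelta_conj_right_all L H' μ)) v) (mH v) (mG v) ∧
          (v ∉ Sbad → IsLocalUnitTransfer L H' v ((finExplicitCollection L H' μ (finExplicitDelta_conj_left_all L H' μ) (finExplicitDelta_conj_right_all L H' μ)) v) (mH v) (mG v)) ∧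
          (mH v).IsCanonical (IsLocalGRegular L v) (νH v) ∧
          (mG v).IsCanonical (fun γ => IsRegularElt (γ.val : GL (Fin 3) (UnitaryGroup.LocalRing L v))) (νG v)) ∧
        IsAlmostEverywhereTrivial L H' (finExplicitCollection L H' μ (finExplicitDelta_conj_left_all L H' μ) (finExplicitDelta_conj_right_all L H' μ)) ∧
        SatisfiesProductFormula L H' (finExplicitCollection L H' μ (finExplicitDelta_conj_left_all L H' μ) (finExplicitDelta_conj_right_all L H' μ))
      (fun a b => archCanonicalDelta L H' a μ b) ∧
        ((∀ x : Fin 3 → L, hermForm (cmConjRingHom L) H' x x = 0 → x = 0) →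
      ∀ (hH : (H'.map (cmConjRingHom L))ᵀ = H') (hHd : IsUnit H'.det)
        (γ₀ : (UnitaryGroup.cmDatum L 3 H').Rational) (hreg : IsRegularElt (γ₀.val : GL (Fin 3) L))
        [Fintype (cartanIndexCM hH hHd hreg)]
        (s : {𝒪H : StableClassH (cmConjRingHom L) (Matrix.of fun i j : Fin 2 => if i.val + j.val + 1 = 2 then (1 : L) else 0)
                (Matrix.of fun i j : Fin 1 => if i.val + j.val + 1 = 1 then (1 : L) else 0) //
              𝒪H.TransfersTo H' endoForm_antidiagOne (stableClassOf (cmConjRingHom L) H' γ₀)} → cartanIndexCM hH hHd hreg)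
        (e : {𝒪H : StableClassH (cmConjRingHom L) (Matrix.of fun i j : Fin 2 => if i.val + j.val + 1 = 2 then (1 : L) else 0)
                (Matrix.of fun i j : Fin 1 => if i.val + j.val + 1 = 1 then (1 : L) else 0) //
              𝒪H.TransfersTo H' endoForm_antidiagOne (stableClassOf (cmConjRingHom L) H' γ₀)} ≃
            {χ : (⊤ : Subgroup (AddChar ↥(cartanObsSubgroup (cartanIndexCM hH hHd hreg)) ℂ)) // χ ≠ 1}),
        Function.Injective s →
        (∀ 𝔪 : cartanIndexCM hH hHd hreg, (∃ x, s x = 𝔪) ↔ Module.finrank L (↥(Algebra.adjoin L ({(((γ₀ : unitaryGroup (cmConjRingHom L) H').val : GL (Fin 3) L) : Matrix (Fin 3) (Fin 3) L)} :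
                    Set (Matrix (Fin 3) (Fin 3) L))) ⧸ 𝔪.1.asIdeal) = 1) →
        (∀ x, (⟨(((γ₀ : unitaryGroup (cmConjRingHom L) H').val : GL (Fin 3) L) : Matrix (Fin 3) (Fin 3) L), Algebra.self_mem_adjoin_singleton L _⟩ :
                ↥(Algebra.adjoin L ({(((γ₀ : unitaryGroup (cmConjRingHom L) H').val : GL (Fin 3) L) : Matrix (Fin 3) (Fin 3) L)} :
                    Set (Matrix (Fin 3) (Fin 3) L)))) -
            algebraMap L _ x.1.sndVal ∈ (s x).1.asIdeal) →
        (∀ x (ε : ↥(cartanObsSubgroup (cartanIndexCM hH hHd hreg))),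
            (((e x : (⊤ : Subgroup (AddChar ↥(cartanObsSubgroup (cartanIndexCM hH hHd hreg)) ℂ))) : AddChar ↥(cartanObsSubgroup (cartanIndexCM hH hHd hreg)) ℂ)) ε =
              (-1 : ℂ) ^ ((ε : cartanIndexCM hH hHd hreg → ZMod 2) (s x)).val) →
        ∀ (γH : (UnitaryGroup.cmDatum L 2 (Matrix.of fun i j : Fin 2 => if i.val + j.val + 1 = 2 then (1 : L) else 0)).Rational ×
            (UnitaryGroup.cmDatum L 1 (Matrix.of fun i j : Fin 1 => if i.val + j.val + 1 = 1 then (1 : L) else 0)).Rational)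
          (hγ : IsNormPair L H' γH γ₀),
          GlobalKappaFormula L H' (finExplicitCollection L H' μ (finExplicitDelta_conj_left_all L H' μ) (finExplicitDelta_conj_right_all L H' μ))
            (fun a b => archCanonicalDelta L H' a μ b)
            (fun p : MatchingAdele L H' γH => MatchingAdeleG₂.cartanObs hH hHd hreg (MatchingAdele.toSelf hγ p))
            (((e ⟨stableClassHOf (cmConjRingHom L) _ _ γH, hγ⟩).1 :
                (⊤ : Subgroup (AddChar ↥(cartanObsSubgroup (cartanIndexCM hH hHd hreg)) ℂ))) : AddChar ↥(cartanObsSubgroup (cartanIndexCM hH hHd hreg)) ℂ)))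
    (hQ :
      letI : ∀ (v : HeightOneSpectrum (𝓞 ↥(maximalRealSubfield L)))
          (a : ((UnitaryGroup.cmDatum L 2 (Matrix.of fun i j : Fin 2 => if i.val + j.val + 1 = 2 then (1 : L) else 0)).Local v ×
            (UnitaryGroup.cmDatum L 1 (Matrix.of fun i j : Fin 1 => if i.val + j.val + 1 = 1 then (1 : L) else 0)).Local v)),
          MeasurableSpace (((UnitaryGroup.cmDatum L 2 (Matrix.of fun i j : Fin 2 => if i.val + j.val + 1 = 2 then (1 : L) else 0)).Local v ×
            (UnitaryGroup.cmDatum L 1 (Matrix.of fun i j : Fin 1 => if i.val + j.val + 1 = 1 then (1 : L) else 0)).Local v) ⧸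
            Subgroup.centralizer ({a} : Set ((UnitaryGroup.cmDatum L 2 (Matrix.of fun i j : Fin 2 => if i.val + j.val + 1 = 2 then (1 : L) else 0)).Local v ×
            (UnitaryGroup.cmDatum L 1 (Matrix.of fun i j : Fin 1 => if i.val + j.val + 1 = 1 then (1 : L) else 0)).Local v))) :=
        fun _ _ => borel _
      haveI : ∀ (v : HeightOneSpectrum (𝓞 ↥(maximalRealSubfield L)))
          (a : ((UnitaryGroup.cmDatum L 2 (Matrix.of fun i j : Fin 2 => if i.val + j.val + 1 = 2 then (1 : L) else 0)).Local v ×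
            (UnitaryGroup.cmDatum L 1 (Matrix.of fun i j : Fin 1 => if i.val + j.val + 1 = 1 then (1 : L) else 0)).Local v)),
          BorelSpace (((UnitaryGroup.cmDatum L 2 (Matrix.of fun i j : Fin 2 => if i.val + j.val + 1 = 2 then (1 : L) else 0)).Local v ×
            (UnitaryGroup.cmDatum L 1 (Matrix.of fun i j : Fin 1 => if i.val + j.val + 1 = 1 then (1 : L) else 0)).Local v) ⧸
            Subgroup.centralizer ({a} : Set ((UnitaryGroup.cmDatum L 2 (Matrix.of fun i j : Fin 2 => if i.val + j.val + 1 = 2 then (1 : L) else 0)).Local v ×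
            (UnitaryGroup.cmDatum L 1 (Matrix.of fun i j : Fin 1 => if i.val + j.val + 1 = 1 then (1 : L) else 0)).Local v))) :=
        fun _ _ => ⟨rfl⟩
      letI : ∀ (v : HeightOneSpectrum (𝓞 ↥(maximalRealSubfield L))) (γ : (UnitaryGroup.cmDatum L 3 H').Local v),
          MeasurableSpace ((UnitaryGroup.cmDatum L 3 H').Local v ⧸ Subgroup.centralizer ({γ} : Set ((UnitaryGroup.cmDatum L 3 H').Local v))) :=
        fun _ _ => borel _
      haveI : ∀ (v : HeightOneSpectrum (𝓞 ↥(maximalRealSubfield L))) (γ : (UnitaryGroup.cmDatum L 3 H').Local v),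
          BorelSpace ((UnitaryGroup.cmDatum L 3 H').Local v ⧸ Subgroup.centralizer ({γ} : Set ((UnitaryGroup.cmDatum L 3 H').Local v))) :=
        fun _ _ => ⟨rfl⟩
      ∀ (mH : ∀ v : HeightOneSpectrum (𝓞 ↥(maximalRealSubfield L)),
          OrbitalMeasureFamily ((UnitaryGroup.cmDatum L 2 (Matrix.of fun i j : Fin 2 => if i.val + j.val + 1 = 2 then (1 : L) else 0)).Local v ×
          (UnitaryGroup.cmDatum L 1 (Matrix.of fun i j : Fin 1 => if i.val + j.val + 1 = 1 then (1 : L) else 0)).Local v))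
        (mG : ∀ v : HeightOneSpectrum (𝓞 ↥(maximalRealSubfield L)), OrbitalMeasureFamily ((UnitaryGroup.cmDatum L 3 H').Local v)),
        (∀ v : HeightOneSpectrum (𝓞 ↥(maximalRealSubfield L)),
            (mH v).IsCanonical (IsLocalGRegular L v) (νH v) ∧
              (mG v).IsCanonical (fun γ => IsRegularElt (γ.val : GL (Fin 3) (UnitaryGroup.LocalRing L v))) (νG v)) →
          Q (finExplicitCollection L H' μ (finExplicitDelta_conj_left_all L H' μ) (finExplicitDelta_conj_right_all L H' μ)) mH mG) :
    GlobalTransferWithStabilisationPackageAnd L H' (fun a b => archCanonicalDelta L H' a μ b) νH νG Q := by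
  intro hKG hKH
  obtain ⟨Sbad, mH, mG, hloc, hae, hpf, hκ⟩ := hJ hKG hKH
  exact ⟨Sbad, (finExplicitCollection L H' μ (finExplicitDelta_conj_left_all L H' μ) (finExplicitDelta_conj_right_all L H' μ)), mH, mG, hloc, hae, hpf,
    stabilisationPackage_pointed L H' (fun a b => archCanonicalDelta L H' a μ b)
      (finExplicitCollection L H' μ (finExplicitDelta_conj_left_all L H' μ) (finExplicitDelta_conj_right_all L H' μ)) hherm hκ,
    hQ mH mG fun v => ⟨(hloc v).2.2.1, (hloc v).2.2.2⟩⟩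

end Composition


end Summit.HodgeConjecture.HodgeConjecture.Cruxes.H413.F0P3aGlobalTransferPackageAndOfStubs

end
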